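import Mathlib
import HarnessLib

/-!
# Volkov's allocation of Monte-Carlo samples among Feynman graphs (PRD 100, 096004 (2019) §IV.C): the printed probabilities `p_j ∝ C_j/√t_j` MINIMISE the total variance at fixed computing time — PROVED (Cauchy–Schwarz), not only stationary

independent recomputation; certified where stated, statistical where stated; no new-physics claim.

CITATION HEADER (venture `QEDPrecision`, cell `pub-qed`, track TROPICAL seat V3a = `pub-qed-trop-v3-lit-1` gen 9; VALUE-FREE: an
inequality between finite sums of abstract non-negative reals; no graph, no constant, nothing per Set V family or word). Serves
`tropical/view/V3-VOLKOV-DEGREES.md` §A A.1 row V19 («§IV.C inter-graph allocation p_j ∝ C_j/√t_j») and any engine / bench seat that splits a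
sample budget among the graphs (insertions) of a word or among words: the printed rule is the global optimum of the printed cost functional.

Source [Volkov2019]: S. Volkov, "Calculating the five-loop QED contribution to the electron anomalous magnetic moment: Graphs without lepton
loops", Phys. Rev. D 100, 096004 (2019) = arXiv:1909.08015 (e-print `amm5_arxiv.tex`, HOME `data/lit/sources/.cache/1909.08015/`), §IV.C
"Monte Carlo integration: details", VERBATIM (tex l.384–407): "The probabilities p_j of taking the graph j are chosen to make the convergence
as fast as possible. Let us describe the method of obtaining p_j. Put C_j = σ_{↑,j} √N_j, where N_j is the number of samples that have
already been processed for the graph j. By t_j we denote the average time required for evaluation of one integrand value for the graph j. The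
total time that is needed for evaluation of N samples is approximately t = N Σ_j p_j t_j. The total standard deviation can be estimated as
σ² = (1/N) Σ_j (C_j)²/p_j = (1/t) (Σ_j (C_j)²/p_j)(Σ_j p_j t_j) = (1/t) (Σ_j (C_j)² t_j/q_j)(Σ_j q_j), where q_j = p_j t_j. The minimum point
satisfies the equation (∂/∂q_i − ∂/∂q_l)(Σ_j (C_j)² t_j/q_j) = 0 for any i, l. Using this, we obtain q_j = C C_j √t_j, where C is some
constant, or p_j = (C_j/√t_j) / Σ_l (C_l/√t_l). We use this probabilities for random generation of the graph numbers with a little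
modification for stabilization".

WHAT IS PROVED (namespace `Literature.MathematicalPhysics.QuantumFieldTheory.Volkov2019`; the graphs are indexed by a `Finset`; write
`a_j := C_j √t_j`, so that the printed functional is `t·σ² = (Σ_j a_j²/q_j)(Σ_j q_j)` on allocations `q_j > 0`):
* `sq_sum_le_costFunctional` — for every admissible allocation, `(Σ_j a_j)² ≤ (Σ_j a_j²/q_j)(Σ_j q_j)` (Cauchy–Schwarz in Mathlib's form
  `Finset.sum_sq_le_sum_mul_sum_of_sq_le_mul`);
* `costFunctional_printed` — at the printed point `q_j = K·a_j` (`K > 0`, all `a_j > 0`) the functional EQUALS `(Σ_j a_j)²`;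
* `printed_allocation_optimal` — hence the printed allocation minimises `t·σ²` among all allocations with `q_j > 0` (the paper derives
  only the stationarity condition; the functional is scale-invariant in `q`, which is the printed "C is some constant");
* `printed_probability` — with `a_j = C_j √t_j` the printed `q_j` gives `q_j/t_j = C_j/√t_j`, i.e. `p_j ∝ C_j/√t_j` as displayed.
NOT typed: the statistical model behind "σ² can be estimated as …" (σ_{↑,j} is Volkov's improved error estimate of PRD 98 §IV.F, typed in
`Volkov2018/ErrorEstimation.lean`), the "little modification for stabilization", eq. (eq_sigma_sum). 0 named facts, no definitions.
-/

namespace Literature.MathematicalPhysics.QuantumFieldTheory.Volkov2019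

open Finset

variable {ι : Type*}

/-- **Lower bound**: for any weights `a_j` and any allocation `q_j > 0`, `(Σ_j a_j)² ≤ (Σ_j a_j²/q_j)·(Σ_j q_j)` — the printed
`t·σ² = (Σ_j (C_j)² t_j/q_j)(Σ_j q_j)` with `a_j = C_j√t_j` is bounded below by `(Σ_j C_j√t_j)²`, uniformly in the allocation.
[cite: Volkov2019, §IV.C (tex l.395–405)] -/
theorem sq_sum_le_costFunctional (s : Finset ι) {a q : ι → ℝ} (hq : ∀ j ∈ s, 0 < q j) :
    (∑ j ∈ s, a j) ^ 2 ≤ (∑ j ∈ s, a j ^ 2 / q j) * ∑ j ∈ s, q j := by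
  refine Finset.sum_sq_le_sum_mul_sum_of_sq_le_mul s
    (fun j hj => div_nonneg (sq_nonneg _) (hq j hj).le) (fun j hj => (hq j hj).le) fun j hj => ?_
  rw [div_mul_cancel₀ _ (hq j hj).ne']

/-- **The printed point attains it**: at `q_j = K·a_j` (`K > 0`, `a_j > 0`) the functional equals `(Σ_j a_j)²`.
[cite: Volkov2019, §IV.C «q_j = C C_j √t_j, where C is some constant» (tex l.399–402)] -/
theorem costFunctional_printed (s : Finset ι) {a : ι → ℝ} (ha : ∀ j ∈ s, 0 < a j) {K : ℝ} (hK : 0 < K) :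
    (∑ j ∈ s, a j ^ 2 / (K * a j)) * ∑ j ∈ s, K * a j = (∑ j ∈ s, a j) ^ 2 := by
  have h1 : ∑ j ∈ s, a j ^ 2 / (K * a j) = (∑ j ∈ s, a j) / K := by
    rw [Finset.sum_div]
    exact Finset.sum_congr rfl fun j hj => by
      rw [sq, mul_comm K, ← div_div, mul_div_assoc, div_self (ha j hj).ne', mul_one]
  rw [h1, ← Finset.mul_sum]
  field_simp

/-- **Optimality of the printed allocation** (the paper derives the stationarity condition; this is the global statement): for every
allocation `q_j > 0`, `t·σ²` at the printed `q_j = K·a_j` is `≤ t·σ²` at `q`. [cite: Volkov2019, §IV.C (tex l.395–405)] -/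
theorem printed_allocation_optimal (s : Finset ι) {a : ι → ℝ} (ha : ∀ j ∈ s, 0 < a j) {K : ℝ} (hK : 0 < K)
    {q : ι → ℝ} (hq : ∀ j ∈ s, 0 < q j) :
    (∑ j ∈ s, a j ^ 2 / (K * a j)) * ∑ j ∈ s, K * a j ≤ (∑ j ∈ s, a j ^ 2 / q j) * ∑ j ∈ s, q j := by
  rw [costFunctional_printed s ha hK]
  exact sq_sum_le_costFunctional s hq

/-- **The displayed probabilities**: with `a_j = C_j√t_j` and the printed `q_j = C_j√t_j` (constant `C = 1`), the per-sample probability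
`p_j = q_j/t_j` is `C_j/√t_j` — «p_j = (C_j/√t_j) / Σ_l (C_l/√t_l)» after normalisation (meaningful for `t > 0`; Mathlib's `√`
and `x/0 = 0` conventions make the identity hold for every real `t`). [cite: Volkov2019, §IV.C (tex l.403–405)] -/
theorem printed_probability (C t : ℝ) : C * Real.sqrt t / t = C / Real.sqrt t := by
  rw [mul_div_assoc, Real.sqrt_div_self', ← div_eq_mul_one_div]

end Literature.MathematicalPhysics.QuantumFieldTheory.Volkov2019
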